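import Literature.NumberTheory.Automorphic.HidaEngineSymbols
import Literature.NumberTheory.Automorphic.HidaLevelPolynomialAction
import Literature.Algebra.Module.CharacterModuleAnnihilator
import HarnessLib

/-!
# Polynomial actions of commuting families, and the level modules of the support argument

Topic `NumberTheory/Automorphic`; namespaces `Literature.NumberTheory.Automorphic.PolyAction`
(generic) and `Literature.NumberTheory.Automorphic.BigHeckeGLn.TameLevel`; definitions with bodies
and theorems (no named fact, no `sorry`).

**Generic part (`PolyAction`).**  For a commutative ring `S`, an `S`-module `M`, a ring homomorphism
`φ : O → S` and a family `t : σ → End_S M` of pairwise COMMUTING endomorphisms, the polynomial ring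
`O[X_σ]` acts on `M` through the ring homomorphism **`polyHom φ t ht : MvPolynomial σ O →+* End_S M`**
(`X_a ↦ t a`, `C r ↦ φ(r)·`; `eval₂Hom` into the commutative subring generated by the `t a` and the
scalars).  `map_polyHom_apply` is the (twisted, semilinear) functoriality: an additive map `Φ` with
`Φ (t a m) = polyHom φ' t' (θ (X a)) (Φ m)` and `Φ (φ r • m) = φ' r • Φ m` satisfies
`Φ (polyHom φ t z m) = polyHom φ' t' (θ z) (Φ m)` for every ring endomorphism `θ` of `O[X_σ]` fixing
the constants; `restrictFamily` restricts a family to a stable submodule.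

**The level modules.**  For `GL₂` over a number field `K`, a tame level `U` maximal above `p`, a
coefficient ring `O`, a depth `c₀` and a level-depth function `lv : ℕ → ℕ`, let `S_n = O/(p^n)` and
let `E_n(j)` be the `U_p`-ordinary part `⋂_{v ∣ p} ⋂ₘ range U_{v,1}^m` of
`H^j(X_{U(lv n)}, S_n)`, `U(lv n) = U(lv n, max(lv n, 1))` the Hida level (arithmetic-quotient model,
`ArithmeticQuotient.cohomology`).  The symbols
(`HidaEngineSymbols.Syms`: good Hecke elements `t_{w,j}`, `w ∉ S`, and torus data `d`) act by
`[U t_{w,j} U]` and `[U (torusElement d) U] = ∏_v ⟨(û⁰_v, û¹_v)⟩_v`; these operators pairwise commute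
(`HidaTowerLevelsHecke.heckeEnd_level_comm`, `heckeEnd_diamondPi`) and preserve the ordinary part,
so `E_n(j)` is a module over `R = O[Syms]` (`EngMod`, `instModuleEngMod`), finite whenever the
cohomology group is (`Module.Finite` through `Finite`).  These are the modules `M₂(n) = E_n(2)`,
`M₁(n) = E_n(1)^∨` (`CharacterModule`) of the levelwise support argument
(`Literature.Algebra.Module.map_eq_zero_or_map_eq_zero_of_levelwise`).
[cite: Hida1994AIF, §3] [cite: KhareThorne2017, §6.5, Lemma 6.17]

## References

* H. Hida, Ann. Inst. Fourier 44 (1994), §3. [Hida1994AIF]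
* C. Khare, J. A. Thorne, Amer. J. Math. 139 (2017), §6.3–6.5. [KhareThorne2017]
-/

noncomputable section

open MvPolynomial IsDedekindDomain
open scoped NumberField

namespace Literature.NumberTheory.Automorphic

/-! ### Generic: the polynomial action of a commuting family -/

namespace PolyAction

variable {σ O S : Type} [CommRing O] [CommRing S] (φ : O →+* S) {M : Type} [AddCommGroup M] [Module S M]
  (t : σ → Module.End S M)

/-- The generating set: the operators `t a` and the scalars. [folklore] -/
def genSet : Set (Module.End S M) :=
  Set.range t ∪ Set.range fun s : S => algebraMap S (Module.End S M) s

variable {t} in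
/-- The generators pairwise commute when the `t a` do (scalars are central). [folklore] -/
theorem genSet_comm (ht : ∀ a b, Commute (t a) (t b)) :
    ∀ x ∈ genSet t, ∀ y ∈ genSet t, x * y = y * x := by
  rintro x (⟨a, rfl⟩ | ⟨s, rfl⟩) y (⟨b, rfl⟩ | ⟨s', rfl⟩)
  · exact (ht a b).eq
  · exact (Algebra.commutes s' (t a)).symm
  · exact Algebra.commutes s (t b)
  · rw [← map_mul, ← map_mul, mul_comm]

/-- The scalars `C r ↦ φ(r)·` as a homomorphism into the generated subring. [folklore] -/
def scalarHom : O →+* Subring.closure (genSet t) :=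
  ((algebraMap S (Module.End S M)).comp φ).codRestrict _ fun r =>
    Subring.subset_closure (Or.inr ⟨φ r, rfl⟩)

/-- **`polyHom φ t ht : O[X_σ] → End_S M`, `X_a ↦ t a`, `C r ↦ φ(r)·`** (evaluation in the
commutative subring generated by the commuting family and the scalars). [cite: KhareThorne2017, §6.5] -/
def polyHom (ht : ∀ a b, Commute (t a) (t b)) : MvPolynomial σ O →+* Module.End S M :=
  letI : CommRing (Subring.closure (genSet t)) :=
    { (inferInstance : Ring (Subring.closure (genSet t))) with
      mul_comm := (Subring.isMulCommutative_closure (genSet_comm ht)).is_comm.comm }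
  (Subring.closure (genSet t)).subtype.comp
    (eval₂Hom (scalarHom φ t) fun a => ⟨t a, Subring.subset_closure (Or.inl ⟨a, rfl⟩)⟩)

variable {φ t}

/-- `polyHom (X_a) = t a`. [folklore] -/
@[simp]
theorem polyHom_X (ht : ∀ a b, Commute (t a) (t b)) (a : σ) : polyHom φ t ht (X a) = t a := by
  letI : CommRing (Subring.closure (genSet t)) :=
    { (inferInstance : Ring (Subring.closure (genSet t))) with
      mul_comm := (Subring.isMulCommutative_closure (genSet_comm ht)).is_comm.comm }
  change (Subring.closure (genSet t)).subtype
    (eval₂Hom (scalarHom φ t) (fun a => ⟨t a, Subring.subset_closure (Or.inl ⟨a, rfl⟩)⟩) (X a)) = t a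
  rw [coe_eval₂Hom, eval₂_X]
  rfl

/-- `polyHom (C r) = φ(r)·`. [folklore] -/
@[simp]
theorem polyHom_C (ht : ∀ a b, Commute (t a) (t b)) (r : O) :
    polyHom φ t ht (C r) = algebraMap S (Module.End S M) (φ r) := by
  letI : CommRing (Subring.closure (genSet t)) :=
    { (inferInstance : Ring (Subring.closure (genSet t))) with
      mul_comm := (Subring.isMulCommutative_closure (genSet_comm ht)).is_comm.comm }
  change (Subring.closure (genSet t)).subtype
    (eval₂Hom (scalarHom φ t) (fun a => ⟨t a, Subring.subset_closure (Or.inl ⟨a, rfl⟩)⟩) (C r)) = _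
  rw [coe_eval₂Hom, eval₂_C]
  rfl

/-- `polyHom (C r) m = φ r • m`. [folklore] -/
theorem polyHom_C_apply (ht : ∀ a b, Commute (t a) (t b)) (r : O) (m : M) :
    polyHom φ t ht (C r) m = φ r • m := by
  rw [polyHom_C, Module.algebraMap_end_apply]

/-- **Twisted, semilinear functoriality of `polyHom`.**  Let `Φ : M →+ M'` be additive with
`Φ (t a m) = polyHom φ' t' (θ (X a)) (Φ m)` for all symbols `a` and `Φ (φ r • m) = φ' r • Φ m` for all
scalars, where `θ` is a ring endomorphism of `O[X_σ]` fixing the constants.  Then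
`Φ (polyHom φ t z m) = polyHom φ' t' (θ z) (Φ m)` for every `z`. [folklore] -/
theorem map_polyHom_apply (ht : ∀ a b, Commute (t a) (t b)) {S' M' : Type} [CommRing S'] {φ' : O →+* S'}
    [AddCommGroup M'] [Module S' M'] {t' : σ → Module.End S' M'} (ht' : ∀ a b, Commute (t' a) (t' b))
    (θ : MvPolynomial σ O →+* MvPolynomial σ O) (hθ : ∀ r, θ (C r) = C r) (Φ : M →+ M')
    (hΦt : ∀ a m, Φ (t a m) = polyHom φ' t' ht' (θ (X a)) (Φ m))
    (hΦC : ∀ (r : O) (m : M), Φ (φ r • m) = φ' r • Φ m) (z : MvPolynomial σ O) (m : M) :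
    Φ (polyHom φ t ht z m) = polyHom φ' t' ht' (θ z) (Φ m) := by
  induction z using MvPolynomial.induction_on generalizing m with
  | C r => rw [polyHom_C_apply, hθ, polyHom_C_apply, hΦC]
  | add p q hp hq => rw [map_add, map_add, map_add, LinearMap.add_apply, LinearMap.add_apply, map_add, hp, hq]
  | mul_X q a hq =>
    rw [map_mul (polyHom φ t ht), Module.End.mul_apply, polyHom_X, hq, hΦt, ← Module.End.mul_apply,
      ← map_mul (polyHom φ' t' ht'), ← map_mul θ]

/-- Untwisted, linear case of `map_polyHom_apply`: a linear map intertwining the generators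
intertwines the actions. [folklore] -/
theorem map_polyHom_apply_of_comm (ht : ∀ a b, Commute (t a) (t b)) {M' : Type} [AddCommGroup M'] [Module S M']
    {t' : σ → Module.End S M'} (ht' : ∀ a b, Commute (t' a) (t' b)) (Φ : M →ₗ[S] M')
    (hΦt : ∀ a, Φ ∘ₗ t a = t' a ∘ₗ Φ) (z : MvPolynomial σ O) (m : M) :
    Φ (polyHom φ t ht z m) = polyHom φ t' ht' z (Φ m) := by
  have h := map_polyHom_apply (φ := φ) ht ht' (RingHom.id _) (fun _ => rfl) Φ.toAddMonoidHom
    (fun a m => by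
      change Φ (t a m) = polyHom φ t' ht' (X a) (Φ m)
      rw [polyHom_X, ← LinearMap.comp_apply, hΦt, LinearMap.comp_apply])
    (fun r m => by change Φ (φ r • m) = φ r • Φ m; rw [map_smul]) z m
  exact h

/-- **Restriction of a family to a stable submodule.** [folklore] -/
def restrictFamily (N : Submodule S M) (hN : ∀ a, ∀ m ∈ N, t a m ∈ N) : σ → Module.End S N :=
  fun a => (t a).restrict (hN a)

/-- The restricted family commutes if the family does. [folklore] -/
theorem restrictFamily_comm (ht : ∀ a b, Commute (t a) (t b)) (N : Submodule S M)
    (hN : ∀ a, ∀ m ∈ N, t a m ∈ N) (a b : σ) :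
    Commute (restrictFamily N hN a) (restrictFamily N hN b) := by
  refine LinearMap.ext fun m => Subtype.ext ?_
  change t a (t b (m : M)) = t b (t a (m : M))
  rw [← Module.End.mul_apply, (ht a b).eq, Module.End.mul_apply]

/-- **The restricted action is the action**: `(polyHom (restrictFamily) z n : M) = polyHom t z n`.
[folklore] -/
theorem coe_polyHom_restrictFamily_apply (ht : ∀ a b, Commute (t a) (t b)) (N : Submodule S M)
    (hN : ∀ a, ∀ m ∈ N, t a m ∈ N) (z : MvPolynomial σ O) (n : N) :
    ((polyHom φ (restrictFamily N hN) (restrictFamily_comm ht N hN) z n : N) : M) = polyHom φ t ht z n :=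
  map_polyHom_apply_of_comm (restrictFamily_comm ht N hN) ht N.subtype (fun _ => rfl) z n

/-- `polyHom z` preserves every submodule stable under the family. [folklore] -/
theorem polyHom_apply_mem (ht : ∀ a b, Commute (t a) (t b)) (N : Submodule S M)
    (hN : ∀ a, ∀ m ∈ N, t a m ∈ N) (z : MvPolynomial σ O) {m : M} (hm : m ∈ N) :
    polyHom φ t ht z m ∈ N := by
  rw [← coe_polyHom_restrictFamily_apply ht N hN z ⟨m, hm⟩]
  exact Subtype.mem _

/-- Every `t a` commutes with every `polyHom z`. [folklore] -/
theorem commute_polyHom (ht : ∀ a b, Commute (t a) (t b)) (a : σ) (z : MvPolynomial σ O) :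
    Commute (t a) (polyHom φ t ht z) := by
  have h : polyHom φ t ht (X a) * polyHom φ t ht z = polyHom φ t ht z * polyHom φ t ht (X a) := by
    rw [← map_mul, ← map_mul, mul_comm]
  rw [polyHom_X] at h
  exact h

end PolyAction

/-! ### The level modules `E_n(j)` of the support argument -/

namespace BigHeckeGLn

namespace TameLevel

open PolyAction

/-- The coefficient rings `S_n = O/(p^n)`. [folklore] -/
abbrev engCoeff (p : ℕ) (O : Type) [CommRing O] (n : ℕ) : Type :=
  O ⧸ Ideal.span {((p : O)) ^ n}

variable {K : Type} [Field K] [NumberField K] {p : ℕ} [Fact p.Prime] (𝒰 : TameLevel 2 K p)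
  (O : Type) [CommRing O] (c₀ : ℕ) (lv : ℕ → ℕ)

/-- `H^j(X_{U(lv n)}, S_n)`, `U(lv n) = U(lv n, max(lv n, 1))` the Hida level `hidaLevel (lv n)`
(written as `level`, definitionally equal; arithmetic-quotient model). [cite: KhareThorne2017, §6.3] -/
abbrev engCohomology (n j : ℕ) : ModuleCat (engCoeff p O n) :=
  ArithmeticQuotient.cohomology (engCoeff p O n) (globalEmbedding 2 K) (𝒰.level (lv n) (max (lv n) 1)) (engCoeff p O n) j

/-- Its Hecke operator `[U g U]`. [folklore] -/
abbrev engHecke (n j : ℕ) (g : FiniteAdelicGL 2 K) : Module.End (engCoeff p O n) (𝒰.engCohomology O lv n j) :=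
  ArithmeticQuotient.heckeEnd (engCoeff p O n) (𝒰.level (lv n) (max (lv n) 1)) g (engCoeff p O n) (globalEmbedding 2 K) j

/-- **The `U_p`-ordinary part `⋂_{v ∣ p} ⋂ₘ range U_{v,1}^m` of `H^j(X_{U(lv n)}, S_n)`.**
[cite: KhareThorne2017, §2.4, Lemma 2.10] -/
def engOrd (n j : ℕ) : Submodule (engCoeff p O n) (𝒰.engCohomology O lv n j) :=
  ⨅ (v : PlacesAbove K p) (m : ℕ), LinearMap.range (𝒰.engHecke O lv n j (heckeElement 2 K v.1 1) ^ m)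

/-- **The symbols act**: `X_g ↦ [U g U]` (`g` good), `X_d ↦ [U (torusElement d) U]`. [cite: KhareThorne2017, §6.5] -/
def engFamily (n j : ℕ) : 𝒰.Syms c₀ → Module.End (engCoeff p O n) (𝒰.engCohomology O lv n j) :=
  Sum.elim (fun g => 𝒰.engHecke O lv n j g.1) (fun d => 𝒰.engHecke O lv n j d.torusElement)

variable {O c₀ lv}

/-- `engFamily` on a good symbol. [folklore] -/
@[simp]
theorem engFamily_inl (n j : ℕ) (g : 𝒰.goodElements) : 𝒰.engFamily O c₀ lv n j (Sum.inl g) = 𝒰.engHecke O lv n j g.1 :=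
  rfl

/-- `engFamily` on a torus symbol. [folklore] -/
@[simp]
theorem engFamily_inr (n j : ℕ) (d : TorusDatum K p c₀) :
    𝒰.engFamily O c₀ lv n j (Sum.inr d) = 𝒰.engHecke O lv n j d.torusElement :=
  rfl

/-- `[U (torusElement d) U] = levelTorus (d.units)`. [folklore] -/
theorem engHecke_torusElement (h𝒰 : 𝒰.IsMaximalAbove) (n j : ℕ) (d : TorusDatum K p c₀) :
    𝒰.engHecke O lv n j d.torusElement = 𝒰.levelTorus h𝒰 (lv n) (max (lv n) 1) (engCoeff p O n) (engCoeff p O n) j d.units :=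
  𝒰.heckeEnd_diamondPi h𝒰 (lv n) (max (lv n) 1) (engCoeff p O n) (engCoeff p O n) j d.units

/-- The operator of a Hida element commutes with `levelTorus u`. [folklore] -/
theorem commute_engHecke_levelTorus (h𝒰 : 𝒰.IsMaximalAbove) (n j : ℕ) {g : FiniteAdelicGL 2 K}
    (hg : g ∈ 𝒰.hidaElements) (u : ∀ v : PlacesAbove K p, Fin 2 → (v.1.adicCompletionIntegers K)ˣ) :
    Commute (𝒰.engHecke O lv n j g) (𝒰.levelTorus h𝒰 (lv n) (max (lv n) 1) (engCoeff p O n) (engCoeff p O n) j u) := by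
  classical
  rw [levelTorus, MonoidHom.noncommPiCoprod_apply]
  refine Finset.noncommProd_commute _ _ _ _ fun v _ => ?_
  rw [levelDiamond_apply]
  exact heckeEnd_level_comm 𝒰 h𝒰 (engCoeff p O n) (engCoeff p O n) (lv n) (max (lv n) 1) hg
    (𝒰.diamondElement_mem_hidaElements v.2 (u v)) j

/-- **The operators of the symbols pairwise commute.** [cite: KhareThorne2017, §6.2, Lemma 6.5] -/
theorem engFamily_comm [h𝒰 : Fact 𝒰.IsMaximalAbove] (n j : ℕ) (a b : 𝒰.Syms c₀) :
    Commute (𝒰.engFamily O c₀ lv n j a) (𝒰.engFamily O c₀ lv n j b) := by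
  rcases a with g | d <;> rcases b with g' | d'
  · exact heckeEnd_level_comm 𝒰 h𝒰.out (engCoeff p O n) (engCoeff p O n) (lv n) (max (lv n) 1)
      (𝒰.goodElements_subset_hidaElements g.2) (𝒰.goodElements_subset_hidaElements g'.2) j
  · rw [engFamily_inl, engFamily_inr, 𝒰.engHecke_torusElement h𝒰.out]
    exact 𝒰.commute_engHecke_levelTorus h𝒰.out n j (𝒰.goodElements_subset_hidaElements g.2) d'.units
  · rw [engFamily_inl, engFamily_inr, 𝒰.engHecke_torusElement h𝒰.out]
    exact (𝒰.commute_engHecke_levelTorus h𝒰.out n j (𝒰.goodElements_subset_hidaElements g'.2) d.units).symm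
  · rw [engFamily_inr, engFamily_inr, 𝒰.engHecke_torusElement h𝒰.out, 𝒰.engHecke_torusElement h𝒰.out]
    change _ * _ = _ * _
    rw [← map_mul, ← map_mul, mul_comm]

/-- The operators of the symbols commute with every `U_{v,1}`, `v ∣ p`. [folklore] -/
theorem commute_engFamily_up [h𝒰 : Fact 𝒰.IsMaximalAbove] (n j : ℕ) (a : 𝒰.Syms c₀) (v : PlacesAbove K p) :
    Commute (𝒰.engFamily O c₀ lv n j a) (𝒰.engHecke O lv n j (heckeElement 2 K v.1 1)) := by
  rcases a with g | d
  · exact heckeEnd_level_comm 𝒰 h𝒰.out (engCoeff p O n) (engCoeff p O n) (lv n) (max (lv n) 1)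
      (𝒰.goodElements_subset_hidaElements g.2) (𝒰.heckeElement_mem_hidaElements (Or.inr v.2) 1) j
  · rw [engFamily_inr, 𝒰.engHecke_torusElement h𝒰.out]
    exact (𝒰.commute_engHecke_levelTorus h𝒰.out n j (𝒰.heckeElement_mem_hidaElements (Or.inr v.2) 1) d.units).symm

/-- **The operators of the symbols preserve the ordinary part.** [cite: KhareThorne2017, §6.3] -/
theorem engFamily_apply_mem_engOrd [Fact 𝒰.IsMaximalAbove] (n j : ℕ) (a : 𝒰.Syms c₀)
    {x : 𝒰.engCohomology O lv n j} (hx : x ∈ 𝒰.engOrd O lv n j) : 𝒰.engFamily O c₀ lv n j a x ∈ 𝒰.engOrd O lv n j := by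
  simp only [engOrd, Submodule.mem_iInf] at hx ⊢
  intro v
  have hc : 𝒰.engFamily O c₀ lv n j a ∘ₗ 𝒰.engHecke O lv n j (heckeElement 2 K v.1 1) =
      𝒰.engHecke O lv n j (heckeElement 2 K v.1 1) ∘ₗ 𝒰.engFamily O c₀ lv n j a :=
    (𝒰.commute_engFamily_up n j a v).eq
  exact (Submodule.mem_iInf _).1 (mapsTo_iInf_range_pow_of_comp_eq hc ((Submodule.mem_iInf _).2 (hx v)))

variable (O c₀ lv)

/-- **The level module `E_n(j)`**: the ordinary part of `H^j(X_{U(lv n, max(lv n, 1))}, S_n) = H^j(X_{U(lv n)}, S_n)` (the Hida level `hidaLevel (lv n)`, definitionally) as a type.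
[cite: Hida1994AIF, §3] [cite: KhareThorne2017, §6.5] -/
def EngMod (n j : ℕ) : Type :=
  𝒰.engOrd O lv n j

/-- Additive group structure of `E_n(j)` (that of the submodule). [folklore] -/
instance (n j : ℕ) : AddCommGroup (𝒰.EngMod O lv n j) :=
  inferInstanceAs (AddCommGroup (𝒰.engOrd O lv n j))

/-- `S_n`-module structure of `E_n(j)` (that of the submodule). [folklore] -/
instance instModuleCoeffEngMod (n j : ℕ) : Module (engCoeff p O n) (𝒰.EngMod O lv n j) :=
  inferInstanceAs (Module (engCoeff p O n) (𝒰.engOrd O lv n j))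

/-- `E_n(j)` is finite when the cohomology group is. [folklore] -/
instance (n j : ℕ) [Finite (𝒰.engCohomology O lv n j)] : Finite (𝒰.EngMod O lv n j) :=
  inferInstanceAs (Finite (𝒰.engOrd O lv n j))

/-- The underlying cohomology class of an element of `E_n(j)`. [folklore] -/
instance instCoeOutEngMod (n j : ℕ) : CoeOut (𝒰.EngMod O lv n j) (𝒰.engCohomology O lv n j) :=
  ⟨fun m => (show 𝒰.engOrd O lv n j from m).1⟩

variable {O lv} in
/-- Elements of `E_n(j)` are ordinary classes. [folklore] -/
theorem EngMod.coe_mem {n j : ℕ} (m : 𝒰.EngMod O lv n j) : (m : 𝒰.engCohomology O lv n j) ∈ 𝒰.engOrd O lv n j :=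
  (show 𝒰.engOrd O lv n j from m).2

variable {O lv} in
/-- Extensionality for `E_n(j)` through the underlying class. [folklore] -/
theorem EngMod.ext {n j : ℕ} {m m' : 𝒰.EngMod O lv n j}
    (h : (m : 𝒰.engCohomology O lv n j) = (m' : 𝒰.engCohomology O lv n j)) : m = m' :=
  Subtype.ext h

variable {O lv} in
/-- The class of `0` is `0`. [folklore] -/
@[simp]
theorem EngMod.coe_zero {n j : ℕ} : ((0 : 𝒰.EngMod O lv n j) : 𝒰.engCohomology O lv n j) = 0 :=
  rfl

/-- An ordinary class as an element of `E_n(j)`. [folklore] -/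
def EngMod.mk {n j : ℕ} (x : 𝒰.engCohomology O lv n j) (hx : x ∈ 𝒰.engOrd O lv n j) : 𝒰.EngMod O lv n j :=
  (⟨x, hx⟩ : 𝒰.engOrd O lv n j)

variable {O lv} in
/-- The class of `EngMod.mk x hx` is `x`. [folklore] -/
@[simp]
theorem EngMod.coe_mk {n j : ℕ} (x : 𝒰.engCohomology O lv n j) (hx : x ∈ 𝒰.engOrd O lv n j) :
    ((EngMod.mk 𝒰 O lv x hx : 𝒰.EngMod O lv n j) : 𝒰.engCohomology O lv n j) = x :=
  rfl

/-- The restricted family of the symbols on `E_n(j)`. [folklore] -/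
def engFamilyOrd [Fact 𝒰.IsMaximalAbove] (n j : ℕ) : 𝒰.Syms c₀ → Module.End (engCoeff p O n) (𝒰.EngMod O lv n j) :=
  restrictFamily (𝒰.engOrd O lv n j) fun a _ hx => 𝒰.engFamily_apply_mem_engOrd n j a hx

/-- The restricted family commutes. [folklore] -/
theorem engFamilyOrd_comm [Fact 𝒰.IsMaximalAbove] (n j : ℕ) (a b : 𝒰.Syms c₀) :
    Commute (𝒰.engFamilyOrd O c₀ lv n j a) (𝒰.engFamilyOrd O c₀ lv n j b) :=
  restrictFamily_comm (𝒰.engFamily_comm n j) _ _ a b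

/-- **`ρ_n : O[Syms] → End E_n(j)`**, the polynomial action on the level module. [cite: KhareThorne2017, §6.5] -/
def engPolyHom [Fact 𝒰.IsMaximalAbove] (n j : ℕ) :
    MvPolynomial (𝒰.Syms c₀) O →+* Module.End (engCoeff p O n) (𝒰.EngMod O lv n j) :=
  polyHom (Ideal.Quotient.mk _) (𝒰.engFamilyOrd O c₀ lv n j) (𝒰.engFamilyOrd_comm O c₀ lv n j)

/-- **`E_n(j)` as an `O[Syms]`-module.** [cite: Hida1994AIF, §3] [cite: KhareThorne2017, §6.5] -/
instance instModuleEngMod [Fact 𝒰.IsMaximalAbove] (n j : ℕ) :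
    Module (MvPolynomial (𝒰.Syms c₀) O) (𝒰.EngMod O lv n j) :=
  Module.compHom (𝒰.EngMod O lv n j) (𝒰.engPolyHom O c₀ lv n j)

variable {O c₀ lv}

/-- Unfolding the action: `z • m = ρ_n(z) m`. [folklore] -/
theorem engSmul_def [Fact 𝒰.IsMaximalAbove] {n j : ℕ} (z : MvPolynomial (𝒰.Syms c₀) O) (m : 𝒰.EngMod O lv n j) :
    z • m = 𝒰.engPolyHom O c₀ lv n j z m :=
  rfl

/-- The polynomial action on the whole cohomology group. [folklore] -/
abbrev engPolyHomFull [Fact 𝒰.IsMaximalAbove] (n j : ℕ) :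
    MvPolynomial (𝒰.Syms c₀) O →+* Module.End (engCoeff p O n) (𝒰.engCohomology O lv n j) :=
  polyHom (Ideal.Quotient.mk _) (𝒰.engFamily O c₀ lv n j) (𝒰.engFamily_comm n j)

/-- **The action on `E_n(j)` is the restriction of the action on `H^j`**: `(z • m : H^j) = ρ(z) m`.
[folklore] -/
theorem coe_engSmul [Fact 𝒰.IsMaximalAbove] {n j : ℕ} (z : MvPolynomial (𝒰.Syms c₀) O) (m : 𝒰.EngMod O lv n j) :
    ((z • m : 𝒰.EngMod O lv n j) : 𝒰.engCohomology O lv n j) = 𝒰.engPolyHomFull n j z (m : 𝒰.engCohomology O lv n j) :=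
  coe_polyHom_restrictFamily_apply (𝒰.engFamily_comm n j) _ _ z m

/-- **`z` kills `E_n(j)` iff `ρ(z)` kills the ordinary part of `H^j`.** [folklore] -/
theorem forall_engSmul_eq_zero_iff [Fact 𝒰.IsMaximalAbove] {n j : ℕ} (z : MvPolynomial (𝒰.Syms c₀) O) :
    (∀ m : 𝒰.EngMod O lv n j, z • m = 0) ↔
      ∀ x ∈ 𝒰.engOrd O lv n j, 𝒰.engPolyHomFull n j z x = 0 := by
  constructor
  · intro h x hx
    have := congrArg (fun m : 𝒰.EngMod O lv n j => (m : 𝒰.engCohomology O lv n j)) (h (EngMod.mk 𝒰 O lv x hx))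
    simpa only [coe_engSmul, EngMod.coe_mk, EngMod.coe_zero] using this
  · intro h m
    exact EngMod.ext 𝒰 ((𝒰.coe_engSmul z m).trans (h _ (EngMod.coe_mem 𝒰 m)))

/-- `E_n(j)` is a finite `O[Syms]`-module when the cohomology group is finite. [folklore] -/
instance [Fact 𝒰.IsMaximalAbove] (n j : ℕ) [Finite (𝒰.engCohomology O lv n j)] :
    Module.Finite (MvPolynomial (𝒰.Syms c₀) O) (𝒰.EngMod O lv n j) :=
  Module.Finite.of_finite

/-- The dual `E_n(j)^∨` is finite when the cohomology group is. [folklore] -/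
instance (n j : ℕ) [Finite (𝒰.engCohomology O lv n j)] : Finite (CharacterModule (𝒰.EngMod O lv n j)) :=
  (Literature.Algebra.Module.natCard_characterModule_le (M := 𝒰.EngMod O lv n j)).1

/-- The dual `E_n(j)^∨` is a finite `O[Syms]`-module when the cohomology group is finite. [folklore] -/
instance [Fact 𝒰.IsMaximalAbove] (n j : ℕ) [Finite (𝒰.engCohomology O lv n j)] :
    Module.Finite (MvPolynomial (𝒰.Syms c₀) O) (CharacterModule (𝒰.EngMod O lv n j)) :=
  Module.Finite.of_finite

end TameLevel

end BigHeckeGLn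

end Literature.NumberTheory.Automorphic
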